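import Mathlib
import Summits.ResolutionOfSingularities.ResolutionOfSingularities.Theses.AbhyankarShadows
import Summits.ResolutionOfSingularities.ResolutionOfSingularities.Theorems.ResidueTranscendenceReduction.Negative.NotPerfectRebase

/-!
# `SemivaluationShadows` (crux stmt-ResolutionOfSingularities-16757, route `AbhyankarShadows`):
# the hypotheses "`O` rational" and "`K/k` finitely generated" are load-bearing

Negative-side load-bearing analysis (cdisprove seat refuter-cdisprove-stmt-ResolutionOfSingularities-16757-0,
2026-08-17), everything PROVED, no definition introduced (the hypothesis-deleted variants of the
crux are stated INLINE, verbatim copies of `AbhyankarShadows.SemivaluationShadows` with one hypothesis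
removed each):

* `semivaluationShadows_false_without_rational` — delete `∀ x ∈ O, ∃ c : k, O.valuation (x - c) < 1`
  (rationality of `O`): FALSE, witness `k = 𝔽̄₂`, `K = k(X)`, `O = ⊤` (the trivial valuation ring),
  `R = k`, `F = ∅`.  A shadow makes the centre `{y ∈ R₁ : ν y < 1}` of `O` on the model `R₁` equal to
  `φ⁻¹(𝔪_{O'})` with `O'` RATIONAL, i.e. a `k`-point of `Spec R₁`; for `O = ⊤` the centre is `(0)`,
  forcing `R₁ ⊆ k`, against `Frac R₁ = k(X)`.
* `semivaluationShadows_false_without_fg` — delete `(⊤ : IntermediateField k K).FG`: FALSE, witness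
  `k = 𝔽̄₂`, `K = k((X))`, `O = k⟦X⟧` (rational over `k`), `R = k`, `F = ∅`: the conclusion's
  `∃ R₁ f.g., Frac R₁ = K` makes `K` countable, but `#k((X)) ≥ 𝔠`.

Companion file `FalseWithoutRfg.lean`: `R.FG` is load-bearing (witness `O = R = 𝒪∞ ⊆ k(X)`).
Moral for provers: rationality of `O` enters exactly through "same centre + `O'` rational ⇒ the
centre of `O` on `R₁` is a closed `k`-point"; finite generation of `K/k` enters exactly through
the model `R₁`.  Neither lemma refutes the crux.  (`k ⊆ O` is implied by `R ≤ O`; `p.Prime`/`CharP`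
are believed to be decoration.)  Full analysis: crux work file `Cruxes/SemivaluationShadows/Disproof.lean`.
-/

noncomputable section

set_option linter.dupNamespace false

namespace Summit.ResolutionOfSingularities.ResolutionOfSingularities.Theorems.SemivaluationShadows.Negative

open Summit.ResolutionOfSingularities.ResolutionOfSingularities.Theorems.ResidueTranscendenceReduction.Negative
  (valuation_top_eq_one)

/-- `k(X)` is generated by `X` over `k` as a field: `⊤ = k⟮X⟯`, hence `⊤.FG`. [folklore] -/
theorem intermediateField_top_fg_ratFunc (k : Type) [Field k] :
    (⊤ : IntermediateField k (RatFunc k)).FG :=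
  ⟨{RatFunc.X}, by simp [RatFunc.adjoin_X]⟩

/-- **`O` rational is load-bearing**: the crux `AbhyankarShadows.SemivaluationShadows` with the
rationality hypothesis on `O` deleted (stated inline, otherwise verbatim) is false — witness
`k = 𝔽̄₂`, `K = k(X)`, `O = ⊤`, `R = k`, `F = ∅`. [folklore] -/
theorem semivaluationShadows_false_without_rational :
    ¬ (∀ p : ℕ, p.Prime → ∀ (k K : Type) [Field k] [CharP k p] [IsAlgClosed k] [Field K]
      [Algebra k K], (⊤ : IntermediateField k K).FG → ∀ O : ValuationSubring K,
      (∀ c : k, algebraMap k K c ∈ O) →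
      ∀ R : Subalgebra k K, R.FG → R.toSubring ≤ O.toSubring → ∀ F : Finset R,
      ∃ (R₁ : Subalgebra k K) (hle : R ≤ R₁) (_ : R₁.toSubring ≤ O.toSubring), R₁.FG ∧
        IsFractionRing R₁ K ∧ ∃ (L : Type) (_ : Field L) (_ : Algebra k L) (φ : R₁ →ₐ[k] L)
        (O' : ValuationSubring L), Module.finrank ℤ (Additive (O'.ValueGroup)ˣ) =
          Module.finrank ℤ (Additive (O.ValueGroup)ˣ) ∧ (∀ y : R₁, φ y ∈ O') ∧
        (∀ y : R₁, O'.valuation (φ y) < 1 ↔ O.valuation (y : K) < 1) ∧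
        (∀ z : L, z ∈ O' → ∃ c : k, O'.valuation (z - algebraMap k L c) < 1) ∧
        (MonoidHom.mrange (O'.valuation.toMonoidWithZeroHom.toMonoidHom.comp
          φ.toRingHom.toMonoidHom)).FG ∧
        ∃ ι : O'.ValueGroup →*₀o O.ValueGroup, Function.Injective ι ∧
          (∀ y : R₁, φ y ≠ 0 → ∃ y' : R₁, ι (O'.valuation (φ y)) = O.valuation (y' : K)) ∧
          ∀ x ∈ F, ι (O'.valuation (φ (Subalgebra.inclusion hle x))) =
            O.valuation ((x : R) : K)) := by
  intro h
  let k := AlgebraicClosure (ZMod 2)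
  let K := RatFunc k
  obtain ⟨R₁, -, -, -, hfrac, L, _, _, φ, O', -, hφO, hcent, hrat', -⟩ :=
    h 2 Nat.prime_two k K (intermediateField_top_fg_ratFunc k) ⊤
      (fun c => ValuationSubring.mem_top _) ⊥ Subalgebra.fg_bot
      (fun x _ => ValuationSubring.mem_top x) ∅
  -- every element of `R₁` is a constant
  have hconst : ∀ y : R₁, (y : K) ∈ Set.range (algebraMap k K) := by
    intro y
    obtain ⟨c, hc⟩ := hrat' (φ y) (hφO y)
    have h1 : φ y - algebraMap k L c = φ (y - algebraMap k R₁ c) := by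
      rw [map_sub, AlgHom.commutes]
    rw [h1, hcent] at hc
    have h0 : ((y - algebraMap k R₁ c : R₁) : K) = 0 := by
      by_contra hne
      exact (lt_irrefl (1 : (⊤ : ValuationSubring K).ValueGroup))
        ((valuation_top_eq_one hne).symm.le.trans_lt hc)
    refine ⟨c, ?_⟩
    have : ((y - algebraMap k R₁ c : R₁) : K) = (y : K) - algebraMap k K c := by
      rw [Subalgebra.coe_sub, Subalgebra.coe_algebraMap]
    rw [this, sub_eq_zero] at h0
    exact h0.symm
  -- hence `K = Frac R₁` consists of constants, which is absurd for `X`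
  obtain ⟨a, b, -, hab⟩ := IsFractionRing.div_surjective (A := R₁) (RatFunc.X : K)
  obtain ⟨ca, hca⟩ := hconst a
  obtain ⟨cb, hcb⟩ := hconst b
  have hX : (RatFunc.X : K) = algebraMap k K (ca / cb) := by
    rw [← hab, map_div₀, hca, hcb]; rfl
  have := congrArg RatFunc.num hX
  rw [RatFunc.num_X, RatFunc.algebraMap_eq_C, RatFunc.num_C] at this
  exact Polynomial.X_ne_C _ this

open Cardinal in
/-- `𝔽̄_p` is countable. [folklore] -/
theorem cardinalMk_algebraicClosure_zmod_le (p : ℕ) [Fact p.Prime] :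
    #(AlgebraicClosure (ZMod p)) ≤ ℵ₀ := by
  have := Algebra.IsAlgebraic.cardinalMk_le_max (ZMod p) (AlgebraicClosure (ZMod p))
  simpa using this

open Cardinal in
/-- A finitely generated subalgebra over a countable field is countable. [folklore] -/
theorem cardinalMk_le_of_fg {k K : Type} [Field k] [Field K] [Algebra k K] (hk : #k ≤ ℵ₀)
    (R₁ : Subalgebra k K) (hfg : R₁.FG) : #R₁ ≤ ℵ₀ := by
  obtain ⟨t, ht⟩ := hfg
  have hsurj : Function.Surjective (fun q : MvPolynomial (↑(t : Set K)) k =>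
      (⟨MvPolynomial.aeval Subtype.val q, by
        rw [← ht, Algebra.adjoin_eq_range]; exact ⟨q, rfl⟩⟩ : R₁)) := by
    rintro ⟨y, hy⟩
    rw [← ht, Algebra.adjoin_eq_range, AlgHom.mem_range] at hy
    obtain ⟨q, rfl⟩ := hy
    exact ⟨q, rfl⟩
  refine (Cardinal.mk_le_of_surjective hsurj).trans (MvPolynomial.cardinalMk_le_max.trans ?_)
  exact max_le (max_le hk (Cardinal.lt_aleph0_of_finite _).le) le_rfl

open Cardinal in
/-- The fraction field of a countable ring is countable. [folklore] -/
theorem cardinalMk_le_of_isFractionRing {A K : Type} [CommRing A] [Field K] [Algebra A K]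
    [IsFractionRing A K] (hA : #A ≤ ℵ₀) : #K ≤ ℵ₀ := by
  have hsurj : Function.Surjective
      (fun ab : A × A => algebraMap A K ab.1 / algebraMap A K ab.2) := by
    intro z
    obtain ⟨a, b, -, h⟩ := IsFractionRing.div_surjective (A := A) z
    exact ⟨(a, b), h⟩
  refine (Cardinal.mk_le_of_surjective hsurj).trans ?_
  rw [Cardinal.mk_prod, Cardinal.lift_id, ← Cardinal.aleph0_mul_aleph0]
  exact mul_le_mul' hA hA

open Cardinal in
/-- `k((X))` has at least continuum many elements (`0/1`-power series). [folklore] -/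
theorem continuum_le_cardinalMk_laurentSeries (k : Type) [Field k] :
    𝔠 ≤ #(LaurentSeries k) := by
  classical
  let f : Set ℕ → LaurentSeries k := fun s =>
    HahnSeries.ofPowerSeries ℤ k (PowerSeries.mk fun n => if n ∈ s then 1 else 0)
  have hf : Function.Injective f := by
    intro s t hst
    have h := HahnSeries.ofPowerSeries_injective hst
    ext n
    have := congrArg (PowerSeries.coeff n) h
    simp only [PowerSeries.coeff_mk] at this
    by_cases hs : n ∈ s <;> by_cases ht : n ∈ t <;> simp_all
  simpa using Cardinal.mk_le_of_injective hf

/-- `algebraMap k k((X)) c` is the constant Hahn series `C c`. [folklore] -/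
theorem algebraMap_laurentSeries_eq_C (k : Type) [Field k] (c : k) :
    algebraMap k (LaurentSeries k) c = HahnSeries.C c := by
  rw [HahnSeries.algebraMap_apply']
  simp

/-- Constants lie in the `X`-adic valuation ring of `k((X))`. [folklore] -/
theorem algebraMap_mem_valuationSubring_laurentSeries (k : Type) [Field k] (c : k) :
    algebraMap k (LaurentSeries k) c ∈ (Valued.v (R := LaurentSeries k)).valuationSubring := by
  rw [Valuation.mem_valuationSubring_iff, algebraMap_laurentSeries_eq_C]
  have h := (LaurentSeries.valuation_le_iff_coeff_lt_eq_zero k (D := 0)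
    (f := HahnSeries.C c)).mpr (fun n hn => by
      rw [HahnSeries.C_apply, HahnSeries.coeff_single, if_neg hn.ne])
  simpa using h

/-- The `X`-adic valuation ring `k⟦X⟧` of `k((X))` is RATIONAL over `k`: `f ≡ f(0) (mod X)`.
[folklore] -/
theorem valuationSubring_laurentSeries_rational (k : Type) [Field k] (x : LaurentSeries k)
    (hx : x ∈ (Valued.v (R := LaurentSeries k)).valuationSubring) :
    ∃ c : k, (Valued.v (R := LaurentSeries k)).valuationSubring.valuation
      (x - algebraMap k (LaurentSeries k) c) < 1 := by
  refine ⟨x.coeff 0, ?_⟩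
  rw [← (Valuation.isEquiv_valuation_valuationSubring _).lt_one_iff_lt_one]
  rw [Valuation.mem_valuationSubring_iff] at hx
  have hx' : ∀ n < (0 : ℤ), x.coeff n = 0 :=
    (LaurentSeries.valuation_le_iff_coeff_lt_eq_zero k (D := 0) (f := x)).mp (by simpa using hx)
  have hle : Valued.v (x - algebraMap k (LaurentSeries k) (x.coeff 0)) ≤
      WithZero.exp (-1 : ℤ) := by
    rw [LaurentSeries.valuation_le_iff_coeff_lt_eq_zero]
    intro n hn
    rw [HahnSeries.coeff_sub, algebraMap_laurentSeries_eq_C, HahnSeries.C_apply,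
      HahnSeries.coeff_single]
    rcases lt_or_eq_of_le (Int.lt_add_one_iff.mp (by omega : n < 0 + 1)) with hn0 | hn0
    · rw [if_neg hn0.ne, hx' n hn0, sub_zero]
    · subst hn0; simp
  refine hle.trans_lt ?_
  rw [← WithZero.exp_zero, WithZero.exp_lt_exp]
  norm_num

open Cardinal in
/-- **`K/k` finitely generated is load-bearing**: the crux `AbhyankarShadows.SemivaluationShadows`
with the hypothesis `(⊤ : IntermediateField k K).FG` deleted (stated inline, otherwise verbatim) is
false — witness `k = 𝔽̄₂`, `K = k((X))`, `O = k⟦X⟧`, `R = k`, `F = ∅` (countability). [folklore] -/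
theorem semivaluationShadows_false_without_fg :
    ¬ (∀ p : ℕ, p.Prime → ∀ (k K : Type) [Field k] [CharP k p] [IsAlgClosed k] [Field K]
      [Algebra k K], ∀ O : ValuationSubring K, (∀ c : k, algebraMap k K c ∈ O) →
      (∀ x : K, x ∈ O → ∃ c : k, O.valuation (x - algebraMap k K c) < 1) →
      ∀ R : Subalgebra k K, R.FG → R.toSubring ≤ O.toSubring → ∀ F : Finset R,
      ∃ (R₁ : Subalgebra k K) (hle : R ≤ R₁) (_ : R₁.toSubring ≤ O.toSubring), R₁.FG ∧
        IsFractionRing R₁ K ∧ ∃ (L : Type) (_ : Field L) (_ : Algebra k L) (φ : R₁ →ₐ[k] L)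
        (O' : ValuationSubring L), Module.finrank ℤ (Additive (O'.ValueGroup)ˣ) =
          Module.finrank ℤ (Additive (O.ValueGroup)ˣ) ∧ (∀ y : R₁, φ y ∈ O') ∧
        (∀ y : R₁, O'.valuation (φ y) < 1 ↔ O.valuation (y : K) < 1) ∧
        (∀ z : L, z ∈ O' → ∃ c : k, O'.valuation (z - algebraMap k L c) < 1) ∧
        (MonoidHom.mrange (O'.valuation.toMonoidWithZeroHom.toMonoidHom.comp
          φ.toRingHom.toMonoidHom)).FG ∧
        ∃ ι : O'.ValueGroup →*₀o O.ValueGroup, Function.Injective ι ∧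
          (∀ y : R₁, φ y ≠ 0 → ∃ y' : R₁, ι (O'.valuation (φ y)) = O.valuation (y' : K)) ∧
          ∀ x ∈ F, ι (O'.valuation (φ (Subalgebra.inclusion hle x))) =
            O.valuation ((x : R) : K)) := by
  intro h
  let k := AlgebraicClosure (ZMod 2)
  let K := LaurentSeries k
  let O : ValuationSubring K := (Valued.v (R := K)).valuationSubring
  obtain ⟨R₁, -, -, hfg1, hfrac, -⟩ :=
    h 2 Nat.prime_two k K O (algebraMap_mem_valuationSubring_laurentSeries k)
      (valuationSubring_laurentSeries_rational k) ⊥ Subalgebra.fg_bot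
      (fun x hx => by
        obtain ⟨c, rfl⟩ := Algebra.mem_bot.mp (show x ∈ (⊥ : Subalgebra k K) from hx)
        exact algebraMap_mem_valuationSubring_laurentSeries k c) ∅
  have hK : #K ≤ ℵ₀ :=
    @cardinalMk_le_of_isFractionRing R₁ K _ _ _ hfrac
      (cardinalMk_le_of_fg (cardinalMk_algebraicClosure_zmod_le 2) R₁ hfg1)
  exact (Cardinal.aleph0_lt_continuum.trans_le
    ((continuum_le_cardinalMk_laurentSeries k).trans hK)).false

end Summit.ResolutionOfSingularities.ResolutionOfSingularities.Theorems.SemivaluationShadows.Negative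

end
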